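import Mathlib.Analysis.Calculus.MeanValue
import Mathlib.MeasureTheory.Integral.IntervalIntegral.FundThmCalculus
import Mathlib.Analysis.SpecialFunctions.ExpDeriv
import Mathlib.Analysis.RCLike.Basic
import Literature.Analysis.ODE.LinearSecondOrder
import HarnessLib

/-!
# A priori bound for the Liouville–Green error term (Olver's Volterra estimate, differential form)

Topic `Literature/Analysis/ODE` (namespace `Literature.Analysis.ODE`). Everything is proved; there
are no definitions.

The engine of Olver's error bounds for the Liouville–Green (WKB) approximation
(F. W. J. Olver, *Asymptotics and Special Functions* (1974), Ch. 6 §2, Thms 2.1–2.2) is the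
following comparison principle, which we isolate in abstract form over `𝕜 = ℝ` or `ℂ`
(`RCLike 𝕜`). On `[a, b]` let `w` solve `w″ = q w` and let `E₁, E₂` solve the COMPARISON equation
`E″ = (q + ρ) E` with constant Wronskian `W(E₂, E₁) = E₂E₁′ − E₂′E₁ = c ≠ 0`, `E₁E₂ ≠ 0`, and
`‖E₁‖/‖E₂‖` non-decreasing. If `w` carries the Cauchy data of `E₁` at `a` and
`‖ρ‖·‖E₁‖·‖E₂‖ ≤ m` (continuous), then on `[a, b]`

  `‖w/E₁ − 1‖ ≤ exp((2/‖c‖) ∫ₐˣ m) − 1`,  `‖(w/E₁)′‖ ≤ (‖c‖/(2‖E₁‖‖E₂‖)) (exp((2/‖c‖) ∫ₐˣ m) − 1)`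

(`norm_lgError_le`; `norm_lgError_le_of_right` is the mirror statement for data at `b` and
`‖E₁‖/‖E₂‖` non-increasing). For the LG pair `E = f^{-1/4}e^{±u∫√f}` one has `c = 2u`,
`‖E₁‖‖E₂‖ = f^{-1/2}`, `ρ = f^{-1/4}(f^{-1/4})″·f^{1/2}·… = √f·F′` with Olver's error-control
function `F`, so `m = |F′|` and the bounds read `|ε| ≤ exp(𝒱(F)/u) − 1`,
`|ε′| ≤ u√f (exp(𝒱(F)/u) − 1)` (files `LiouvilleGreenErrorBound.lean`,
`LiouvilleGreenOscillatory.lean` of this directory).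

Proof (variation of parameters + Grönwall, replacing Olver's resolvent series (2.09)–(2.15)):
the two Wronskians `P = W(E₁, w)`, `P₂ = W(E₂, w)` satisfy `P′ = −ρE₁w`, `P₂′ = −ρE₂w`,
`P(a) = 0`, `P₂(a) = c`, and `c·w = P₂E₁ − PE₂`; hence with `h = w/E₁ − 1`,
`‖P₂ − c‖ ≤ ∫ m(1 + ‖h‖)`, `‖P‖‖E₂‖/‖E₁‖ ≤ ∫ m(1 + ‖h‖)` (fencing lemmas
`image_norm_le_of_norm_deriv_right_le_deriv_boundary'`, the second one on `[a, x]` using the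
monotonicity of `‖E₁‖/‖E₂‖`), so `‖h‖ ≤ G := (2/‖c‖)∫ m(1 + ‖h‖)`, and `G′ ≤ (2/‖c‖) m (1 + G)`
integrates to `1 + G ≤ exp((2/‖c‖)∫ m)`. The factor `2/‖c‖` (instead of Olver's `1/‖c‖` in the
exponential case, where the kernel `1 − e^{2u(v−ξ)}` is bounded by `1` rather than `2`) is the
price of not using the oscillation of the kernel; it is exactly Olver's constant in the
oscillatory case (Thm 2.2).

Also here: the one-sided fundamental theorem of calculus within `[a, b]`
(`hasDerivWithinAt_integral_Icc`), reflection of one-sided derivatives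
(`hasDerivWithinAt_comp_neg_Icc`), and solutions of `w″ = q w` on a compact interval with
one-sided derivatives at the end-points (`exists_solution_Icc`, from `exists_solution_Ioi` of
`LinearSecondOrder.lean`).

## References

* F. W. J. Olver, *Asymptotics and Special Functions*, Academic Press 1974, Ch. 6 §2
  (Thm 2.1, eq. (2.09); Thm 2.2, eq. (2.23)). Key `Olver1974`.
* P. Hartman, *Ordinary Differential Equations*, SIAM 2002, Ch. IV Lemma 1.1. Key `Hartman2002`.
-/

noncomputable section

namespace Literature.Analysis.ODE

open Set Filter intervalIntegral
open _root_.MeasureTheory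
open scoped _root_.Topology

/-- **Fundamental theorem of calculus within a compact interval.** If `φ` is continuous on
`[a, b]` and `t ∈ [a, b]`, then `x ↦ ∫ₐˣ φ` has derivative `φ t` at `t` within `[a, b]`
(Mathlib's `intervalIntegral.integral_hasDerivWithinAt_right` for the filter pair
`FTCFilter.nhdsIcc`). [folklore] -/
theorem hasDerivWithinAt_integral_Icc {E : Type*} [NormedAddCommGroup E] [NormedSpace ℝ E]
    [CompleteSpace E] {φ : ℝ → E} {a b t : ℝ} (hφ : ContinuousOn φ (Icc a b))
    (ht : t ∈ Icc a b) :
    HasDerivWithinAt (fun x ↦ ∫ s in a..x, φ s) (φ t) (Icc a b) t := by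
  haveI : Fact (t ∈ Icc a b) := ⟨ht⟩
  have hint : IntervalIntegrable φ volume a t :=
    (hφ.mono (Icc_subset_Icc_right ht.2)).intervalIntegrable_of_Icc ht.1
  exact integral_hasDerivWithinAt_right hint
    (hφ.stronglyMeasurableAtFilter_nhdsWithin measurableSet_Icc t) (hφ t ht)

variable {𝕜 : Type*} [RCLike 𝕜]

/-- **A priori bound for the Liouville–Green error term, normalised at the left end-point**
(abstract form of Olver 1974, Ch. 6 §2.2–§2.4). On `[a, b]`, over `𝕜 = ℝ` or `ℂ`: let
`w′ = dw`, `dw′ = q w`; let `E_j′ = dE_j`, `dE_j′ = (q + ρ) E_j` (`j = 1, 2`) with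
`E₂ dE₁ − dE₂ E₁ = c ≠ 0`, `E₁ E₂ ≠ 0`, `‖E₁‖/‖E₂‖` non-decreasing, `‖ρ‖‖E₁‖‖E₂‖ ≤ m` with `m`
continuous, and `w(a) = E₁(a)`, `dw(a) = dE₁(a)`. Then for `x ∈ [a, b]`,
`‖w x / E₁ x − 1‖ ≤ exp((2/‖c‖)∫ₐˣ m) − 1` and
`‖W(E₁, w)(x)/E₁(x)²‖ = ‖(w/E₁)′(x)‖ ≤ ‖c‖/(2‖E₁ x‖‖E₂ x‖) · (exp((2/‖c‖)∫ₐˣ m) − 1)`.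
All derivatives are one-sided within `[a, b]`. [cite: Olver1974, Ch. 6 Thm 2.1–2.2 (§2.2–2.4)] -/
theorem norm_lgError_le {a b : ℝ} {w dw E₁ dE₁ E₂ dE₂ q ρ : ℝ → 𝕜} {m : ℝ → ℝ} {c : 𝕜}
    (hw : ∀ x ∈ Icc a b, HasDerivWithinAt w (dw x) (Icc a b) x ∧
      HasDerivWithinAt dw (q x * w x) (Icc a b) x)
    (hE₁ : ∀ x ∈ Icc a b, HasDerivWithinAt E₁ (dE₁ x) (Icc a b) x ∧
      HasDerivWithinAt dE₁ ((q x + ρ x) * E₁ x) (Icc a b) x)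
    (hE₂ : ∀ x ∈ Icc a b, HasDerivWithinAt E₂ (dE₂ x) (Icc a b) x ∧
      HasDerivWithinAt dE₂ ((q x + ρ x) * E₂ x) (Icc a b) x)
    (hW : ∀ x ∈ Icc a b, E₂ x * dE₁ x - dE₂ x * E₁ x = c) (hc : c ≠ 0)
    (hE₁0 : ∀ x ∈ Icc a b, E₁ x ≠ 0) (hE₂0 : ∀ x ∈ Icc a b, E₂ x ≠ 0)
    (hmono : ∀ ⦃t⦄, t ∈ Icc a b → ∀ ⦃x⦄, x ∈ Icc a b → t ≤ x →
      ‖E₂ x‖ * ‖E₁ t‖ ≤ ‖E₁ x‖ * ‖E₂ t‖)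
    (hm : ContinuousOn m (Icc a b)) (hρ : ∀ x ∈ Icc a b, ‖ρ x‖ * (‖E₁ x‖ * ‖E₂ x‖) ≤ m x)
    (h0 : w a = E₁ a) (h1 : dw a = dE₁ a) :
    ∀ x ∈ Icc a b,
      ‖w x / E₁ x - 1‖ ≤ Real.exp (2 / ‖c‖ * ∫ t in a..x, m t) - 1 ∧
      ‖(E₁ x * dw x - dE₁ x * w x) / E₁ x ^ 2‖ ≤
        ‖c‖ / (2 * (‖E₁ x‖ * ‖E₂ x‖)) * (Real.exp (2 / ‖c‖ * ∫ t in a..x, m t) - 1) := by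
  intro x₀ hx₀
  have hab : a ≤ b := hx₀.1.trans hx₀.2
  have ha : a ∈ Icc a b := left_mem_Icc.2 hab
  have hcpos : 0 < ‖c‖ := norm_pos_iff.2 hc
  -- the two Wronskians `P = W(E₁, w)`, `P₂ = W(E₂, w)`, the error term `h`, the majorants
  set P : ℝ → 𝕜 := fun t ↦ E₁ t * dw t - dE₁ t * w t with hP
  set P₂ : ℝ → 𝕜 := fun t ↦ E₂ t * dw t - dE₂ t * w t with hP₂
  set h : ℝ → 𝕜 := fun t ↦ w t / E₁ t - 1 with hh
  set n : ℝ → ℝ := fun t ↦ m t * (1 + ‖h t‖) with hn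
  set I : ℝ → ℝ := fun t ↦ ∫ s in a..t, n s with hI
  set Ψ : ℝ → ℝ := fun t ↦ 2 / ‖c‖ * ∫ s in a..t, m s with hΨ
  have hm0 : ∀ t ∈ Icc a b, 0 ≤ m t := fun t ht ↦ le_trans (by positivity) (hρ t ht)
  -- derivatives of the Wronskians: the `q`-terms cancel
  have hPd : ∀ t ∈ Icc a b, HasDerivWithinAt P (-(ρ t * E₁ t * w t)) (Icc a b) t := fun t ht ↦
    (((hE₁ t ht).1.mul (hw t ht).2).sub ((hE₁ t ht).2.mul (hw t ht).1)).congr_deriv (by ring)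
  have hP₂d : ∀ t ∈ Icc a b, HasDerivWithinAt P₂ (-(ρ t * E₂ t * w t)) (Icc a b) t := fun t ht ↦
    (((hE₂ t ht).1.mul (hw t ht).2).sub ((hE₂ t ht).2.mul (hw t ht).1)).congr_deriv (by ring)
  -- continuity on `[a, b]`
  have hwc : ContinuousOn w (Icc a b) := fun t ht ↦ (hw t ht).1.continuousWithinAt
  have hE₁c : ContinuousOn E₁ (Icc a b) := fun t ht ↦ (hE₁ t ht).1.continuousWithinAt
  have hhc : ContinuousOn h (Icc a b) := (hwc.div hE₁c hE₁0).sub continuousOn_const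
  have hnc : ContinuousOn n (Icc a b) := hm.mul (continuousOn_const.add hhc.norm)
  have hPc : ContinuousOn P (Icc a b) := fun t ht ↦ (hPd t ht).continuousWithinAt
  have hP₂c : ContinuousOn P₂ (Icc a b) := fun t ht ↦ (hP₂d t ht).continuousWithinAt
  have hId : ∀ t ∈ Icc a b, HasDerivWithinAt I (n t) (Icc a b) t := fun t ht ↦
    hasDerivWithinAt_integral_Icc hnc ht
  have hIc : ContinuousOn I (Icc a b) := fun t ht ↦ (hId t ht).continuousWithinAt
  have hΨd : ∀ t ∈ Icc a b, HasDerivWithinAt Ψ (2 / ‖c‖ * m t) (Icc a b) t := fun t ht ↦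
    (hasDerivWithinAt_integral_Icc hm ht).const_mul _
  have hΨc : ContinuousOn Ψ (Icc a b) := fun t ht ↦ (hΨd t ht).continuousWithinAt
  have hIa : I a = 0 := by simp [hI]
  have hΨa : Ψ a = 0 := by simp [hΨ]
  -- `w = E₁ (1 + h)` and the resulting bound of `‖w‖`
  have hwE : ∀ t ∈ Icc a b, w t = E₁ t * (1 + h t) := by
    intro t ht
    simp only [hh]
    field_simp [hE₁0 t ht]
    ring
  have hwn : ∀ t ∈ Icc a b, ‖w t‖ ≤ ‖E₁ t‖ * (1 + ‖h t‖) := by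
    intro t ht
    rw [hwE t ht, norm_mul]
    gcongr
    exact (norm_add_le _ _).trans (by rw [norm_one])
  -- Step 1: `‖P₂ - c‖ ≤ I`
  have h_P₂ : ∀ x ∈ Icc a b, ‖P₂ x - c‖ ≤ I x := by
    have hP₂a : P₂ a - c = 0 := by
      simp only [hP₂]
      rw [h0, h1, hW a ha, sub_self]
    refine image_norm_le_of_norm_deriv_right_le_deriv_boundary' (f := fun t ↦ P₂ t - c)
      (f' := fun t ↦ -(ρ t * E₂ t * w t)) (hP₂c.sub continuousOn_const)
      (fun t ht ↦ ((hP₂d t (Ico_subset_Icc_self ht)).sub_const c).mono_of_mem_nhdsWithin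
        (Icc_mem_nhdsGE_of_mem ht))
      (by rw [hP₂a, norm_zero, hIa]) hIc
      (fun t ht ↦ (hId t (Ico_subset_Icc_self ht)).mono_of_mem_nhdsWithin
        (Icc_mem_nhdsGE_of_mem ht))
      (fun t ht ↦ ?_)
    have ht' := Ico_subset_Icc_self ht
    rw [norm_neg, norm_mul, norm_mul]
    calc ‖ρ t‖ * ‖E₂ t‖ * ‖w t‖ ≤ ‖ρ t‖ * ‖E₂ t‖ * (‖E₁ t‖ * (1 + ‖h t‖)) := by
          gcongr; exact hwn t ht'
      _ = ‖ρ t‖ * (‖E₁ t‖ * ‖E₂ t‖) * (1 + ‖h t‖) := by ring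
      _ ≤ m t * (1 + ‖h t‖) := by gcongr; exact hρ t ht'
  -- Step 2: `‖P‖ ‖E₂‖ ≤ ‖E₁‖ I` (fencing on `[a, x]`, monotonicity of `‖E₁‖/‖E₂‖`)
  have h_P : ∀ x ∈ Icc a b, ‖P x‖ * ‖E₂ x‖ ≤ ‖E₁ x‖ * I x := by
    intro x hx
    have hPa : P a = 0 := by
      simp only [hP]
      rw [h0, h1]
      ring
    have hE₂pos : 0 < ‖E₂ x‖ := norm_pos_iff.2 (hE₂0 x hx)
    set r : ℝ := ‖E₁ x‖ / ‖E₂ x‖ with hr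
    have hr0 : 0 ≤ r := div_nonneg (norm_nonneg _) (norm_nonneg _)
    have hsub : Icc a x ⊆ Icc a b := Icc_subset_Icc_right hx.2
    have hnhds : ∀ t ∈ Ico a x, Icc a b ∈ 𝓝[≥] t := fun t ht ↦
      mem_of_superset (Icc_mem_nhdsGE_of_mem ht) hsub
    have key : ‖P x‖ ≤ r * I x := by
      refine image_norm_le_of_norm_deriv_right_le_deriv_boundary' (a := a) (b := x) (f := P)
        (f' := fun t ↦ -(ρ t * E₁ t * w t)) (hPc.mono hsub)
        (fun t ht ↦ (hPd t (hsub (Ico_subset_Icc_self ht))).mono_of_mem_nhdsWithin (hnhds t ht))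
        (B := fun t ↦ r * I t) (B' := fun t ↦ r * n t)
        (by rw [hPa, norm_zero, hIa, mul_zero]) ((hIc.mono hsub).const_smul r |>.congr ?_)
        (fun t ht ↦ ((hId t (hsub (Ico_subset_Icc_self ht))).const_mul r).mono_of_mem_nhdsWithin
          (hnhds t ht))
        (fun t ht ↦ ?_) (right_mem_Icc.2 hx.1)
      · intro t _; simp
      · have ht' : t ∈ Icc a b := hsub (Ico_subset_Icc_self ht)
        have hmn := hmono ht' hx ht.2.le
        rw [norm_neg, norm_mul, norm_mul]
        calc ‖ρ t‖ * ‖E₁ t‖ * ‖w t‖ ≤ ‖ρ t‖ * ‖E₁ t‖ * (‖E₁ t‖ * (1 + ‖h t‖)) := by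
              gcongr; exact hwn t ht'
          _ = ‖ρ t‖ * ‖E₁ t‖ * (1 + ‖h t‖) * ‖E₁ t‖ := by ring
          _ ≤ ‖ρ t‖ * ‖E₁ t‖ * (1 + ‖h t‖) * (‖E₁ x‖ * ‖E₂ t‖ / ‖E₂ x‖) := by
              gcongr
              rw [le_div_iff₀ hE₂pos]
              linarith
          _ = r * (‖ρ t‖ * (‖E₁ t‖ * ‖E₂ t‖) * (1 + ‖h t‖)) := by
              simp only [hr]; ring
          _ ≤ r * (m t * (1 + ‖h t‖)) := by gcongr; exact hρ t ht'
    calc ‖P x‖ * ‖E₂ x‖ ≤ r * I x * ‖E₂ x‖ := by gcongr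
      _ = ‖E₁ x‖ * I x := by simp only [hr]; field_simp
  -- Step 3: `‖h‖ ≤ (2/‖c‖) I`
  have h_h : ∀ x ∈ Icc a b, ‖h x‖ ≤ 2 / ‖c‖ * I x := by
    intro x hx
    have hE₁pos : 0 < ‖E₁ x‖ := norm_pos_iff.2 (hE₁0 x hx)
    have hcw : c * w x = P₂ x * E₁ x - P x * E₂ x := by
      simp only [hP, hP₂]
      linear_combination (-(w x)) * hW x hx
    have hE₁x := hE₁0 x hx
    have hrepr : h x = (P₂ x - c) / c - P x * E₂ x / (c * E₁ x) := by
      simp only [hh]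
      field_simp
      linear_combination hcw
    rw [hrepr]
    calc ‖(P₂ x - c) / c - P x * E₂ x / (c * E₁ x)‖
        ≤ ‖(P₂ x - c) / c‖ + ‖P x * E₂ x / (c * E₁ x)‖ := norm_sub_le _ _
      _ = ‖P₂ x - c‖ / ‖c‖ + ‖P x‖ * ‖E₂ x‖ / (‖c‖ * ‖E₁ x‖) := by
          simp only [norm_div, norm_mul]
      _ ≤ I x / ‖c‖ + ‖E₁ x‖ * I x / (‖c‖ * ‖E₁ x‖) := by
          gcongr ?_ / _ + ?_ / _
          exacts [h_P₂ x hx, h_P x hx]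
      _ = 2 / ‖c‖ * I x := by
          field_simp
          ring
  -- Step 4 (Grönwall): `1 + (2/‖c‖) I ≤ exp Ψ`
  have h_G : ∀ x ∈ Icc a b, 1 + 2 / ‖c‖ * I x ≤ Real.exp (Ψ x) := by
    have hF : ∀ x ∈ Icc a b, (1 + 2 / ‖c‖ * I x) * Real.exp (-Ψ x) ≤ 1 := by
      refine image_le_of_deriv_right_le_deriv_boundary
        (f := fun t ↦ (1 + 2 / ‖c‖ * I t) * Real.exp (-Ψ t))
        (f' := fun t ↦ 2 / ‖c‖ * n t * Real.exp (-Ψ t) +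
          (1 + 2 / ‖c‖ * I t) * (Real.exp (-Ψ t) * -(2 / ‖c‖ * m t)))
        ((continuousOn_const.add (hIc.const_smul (2 / ‖c‖) |>.congr fun t _ ↦ by simp)).mul
          (hΨc.neg.rexp))
        (fun t ht ↦ ((((hId t (Ico_subset_Icc_self ht)).const_mul (2 / ‖c‖)).const_add 1).mul
          (hΨd t (Ico_subset_Icc_self ht)).neg.exp).mono_of_mem_nhdsWithin
            (Icc_mem_nhdsGE_of_mem ht))
        (B := fun _ ↦ 1) (B' := fun _ ↦ 0) (by simp [hIa, hΨa]) continuousOn_const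
        (fun t _ ↦ hasDerivWithinAt_const _ _ _) (fun t ht ↦ ?_)
      have ht' := Ico_subset_Icc_self ht
      have h1 : ‖h t‖ ≤ 2 / ‖c‖ * I t := h_h t ht'
      have h2 : 0 ≤ m t := hm0 t ht'
      have h3 : 0 < Real.exp (-Ψ t) := Real.exp_pos _
      have : 2 / ‖c‖ * n t * Real.exp (-Ψ t) +
          (1 + 2 / ‖c‖ * I t) * (Real.exp (-Ψ t) * -(2 / ‖c‖ * m t)) =
          2 / ‖c‖ * Real.exp (-Ψ t) * (m t * (‖h t‖ - 2 / ‖c‖ * I t)) := by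
        simp only [hn]; ring
      rw [this]
      exact mul_nonpos_of_nonneg_of_nonpos (by positivity)
        (mul_nonpos_of_nonneg_of_nonpos h2 (by linarith))
    intro x hx
    have := hF x hx
    rw [Real.exp_neg, mul_inv_le_iff₀ (Real.exp_pos _), one_mul] at this
    exact this
  -- conclusions
  have hE₁pos : 0 < ‖E₁ x₀‖ := norm_pos_iff.2 (hE₁0 x₀ hx₀)
  have hE₂pos : 0 < ‖E₂ x₀‖ := norm_pos_iff.2 (hE₂0 x₀ hx₀)
  have hG := h_G x₀ hx₀
  refine ⟨?_, ?_⟩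
  · calc ‖w x₀ / E₁ x₀ - 1‖ = ‖h x₀‖ := rfl
      _ ≤ 2 / ‖c‖ * I x₀ := h_h x₀ hx₀
      _ ≤ Real.exp (Ψ x₀) - 1 := by linarith
  · rw [norm_div, norm_pow]
    calc ‖P x₀‖ / ‖E₁ x₀‖ ^ 2 = ‖P x₀‖ * ‖E₂ x₀‖ / (‖E₁ x₀‖ ^ 2 * ‖E₂ x₀‖) := by
          field_simp
      _ ≤ ‖E₁ x₀‖ * I x₀ / (‖E₁ x₀‖ ^ 2 * ‖E₂ x₀‖) := by gcongr ?_ / _; exact h_P x₀ hx₀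
      _ = 2 / ‖c‖ * I x₀ * (‖c‖ / (2 * (‖E₁ x₀‖ * ‖E₂ x₀‖))) := by
          field_simp
      _ ≤ (Real.exp (Ψ x₀) - 1) * (‖c‖ / (2 * (‖E₁ x₀‖ * ‖E₂ x₀‖))) := by
          gcongr; linarith
      _ = ‖c‖ / (2 * (‖E₁ x₀‖ * ‖E₂ x₀‖)) * (Real.exp (Ψ x₀) - 1) := by ring

/-- Reflection `t ↦ -t` of a one-sided derivative within a compact interval. [folklore] -/
theorem hasDerivWithinAt_comp_neg_Icc {F : Type*} [NormedAddCommGroup F] [NormedSpace ℝ F]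
    {φ : ℝ → F} {φ' : F} {a b y : ℝ} (h : HasDerivWithinAt φ φ' (Icc a b) (-y)) :
    HasDerivWithinAt (fun t ↦ φ (-t)) (-φ') (Icc (-b) (-a)) y := by
  have := h.scomp y (hasDerivWithinAt_neg y (Icc (-b) (-a)))
    (fun t ht ↦ ⟨by linarith [ht.2], by linarith [ht.1]⟩)
  simpa [Function.comp_def] using this

/-- **A priori bound for the Liouville–Green error term, normalised at the right end-point.**
The mirror image of `norm_lgError_le`: if `‖E₁‖/‖E₂‖` is non-increasing and `w` is the solution
with the data of `E₁` at `b`, then `‖w/E₁ - 1‖ ≤ exp((2/‖c‖) ∫ₓᵇ m) - 1` on `[a, b]`, with the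
companion bound for the derivative `W(E₁, w)/E₁²` of `w/E₁` (apply `norm_lgError_le` to
`t ↦ w (-t)` on `[-b, -a]`, as in Olver's remark after (2.04)).
[cite: Olver1974, Ch. 6 Thm 2.1–2.2 (§2.2–2.4)] -/
theorem norm_lgError_le_of_right {a b : ℝ} {w dw E₁ dE₁ E₂ dE₂ q ρ : ℝ → 𝕜} {m : ℝ → ℝ}
    {c : 𝕜}
    (hw : ∀ x ∈ Icc a b, HasDerivWithinAt w (dw x) (Icc a b) x ∧
      HasDerivWithinAt dw (q x * w x) (Icc a b) x)
    (hE₁ : ∀ x ∈ Icc a b, HasDerivWithinAt E₁ (dE₁ x) (Icc a b) x ∧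
      HasDerivWithinAt dE₁ ((q x + ρ x) * E₁ x) (Icc a b) x)
    (hE₂ : ∀ x ∈ Icc a b, HasDerivWithinAt E₂ (dE₂ x) (Icc a b) x ∧
      HasDerivWithinAt dE₂ ((q x + ρ x) * E₂ x) (Icc a b) x)
    (hW : ∀ x ∈ Icc a b, E₂ x * dE₁ x - dE₂ x * E₁ x = c) (hc : c ≠ 0)
    (hE₁0 : ∀ x ∈ Icc a b, E₁ x ≠ 0) (hE₂0 : ∀ x ∈ Icc a b, E₂ x ≠ 0)
    (hmono : ∀ ⦃t⦄, t ∈ Icc a b → ∀ ⦃x⦄, x ∈ Icc a b → x ≤ t →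
      ‖E₂ x‖ * ‖E₁ t‖ ≤ ‖E₁ x‖ * ‖E₂ t‖)
    (hm : ContinuousOn m (Icc a b)) (hρ : ∀ x ∈ Icc a b, ‖ρ x‖ * (‖E₁ x‖ * ‖E₂ x‖) ≤ m x)
    (h0 : w b = E₁ b) (h1 : dw b = dE₁ b) :
    ∀ x ∈ Icc a b,
      ‖w x / E₁ x - 1‖ ≤ Real.exp (2 / ‖c‖ * ∫ t in x..b, m t) - 1 ∧
      ‖(E₁ x * dw x - dE₁ x * w x) / E₁ x ^ 2‖ ≤
        ‖c‖ / (2 * (‖E₁ x‖ * ‖E₂ x‖)) * (Real.exp (2 / ‖c‖ * ∫ t in x..b, m t) - 1) := by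
  intro x hx
  have hx' : -x ∈ Icc (-b) (-a) := ⟨neg_le_neg hx.2, neg_le_neg hx.1⟩
  have hmem : ∀ {y}, y ∈ Icc (-b) (-a) → -y ∈ Icc a b := fun hy ↦
    ⟨by linarith [hy.2], by linarith [hy.1]⟩
  have key := norm_lgError_le (𝕜 := 𝕜) (a := -b) (b := -a)
    (w := fun t ↦ w (-t)) (dw := fun t ↦ -dw (-t))
    (E₁ := fun t ↦ E₁ (-t)) (dE₁ := fun t ↦ -dE₁ (-t))
    (E₂ := fun t ↦ E₂ (-t)) (dE₂ := fun t ↦ -dE₂ (-t))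
    (q := fun t ↦ q (-t)) (ρ := fun t ↦ ρ (-t)) (m := fun t ↦ m (-t)) (c := -c)
    (fun y hy ↦ ⟨hasDerivWithinAt_comp_neg_Icc (by simpa using (hw _ (hmem hy)).1),
      (hasDerivWithinAt_comp_neg_Icc (hw _ (hmem hy)).2).neg.congr_deriv (by simp)⟩)
    (fun y hy ↦ ⟨hasDerivWithinAt_comp_neg_Icc (by simpa using (hE₁ _ (hmem hy)).1),
      (hasDerivWithinAt_comp_neg_Icc (hE₁ _ (hmem hy)).2).neg.congr_deriv (by simp)⟩)
    (fun y hy ↦ ⟨hasDerivWithinAt_comp_neg_Icc (by simpa using (hE₂ _ (hmem hy)).1),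
      (hasDerivWithinAt_comp_neg_Icc (hE₂ _ (hmem hy)).2).neg.congr_deriv (by simp)⟩)
    (fun y hy ↦ by rw [← hW _ (hmem hy)]; ring) (neg_ne_zero.2 hc)
    (fun y hy ↦ hE₁0 _ (hmem hy)) (fun y hy ↦ hE₂0 _ (hmem hy))
    (fun t ht y hy hty ↦ hmono (hmem ht) (hmem hy) (neg_le_neg hty))
    (hm.comp continuous_neg.continuousOn fun y hy ↦ hmem hy) (fun y hy ↦ hρ _ (hmem hy))
    (by simpa using h0) (by simpa using h1) (-x) hx'
  simp only [neg_neg, norm_neg, intervalIntegral.integral_comp_neg] at key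
  refine ⟨key.1, ?_⟩
  convert key.2 using 1
  rw [← norm_neg]
  congr 1
  ring

/-- **Solutions of `w″ = q w` on a compact interval, one-sided at the end-points.** If `q` is
continuous on `[a, b]` and `t₀ ∈ [a, b]`, every datum `(c₀, c₁)` at `t₀` is carried by a solution:
`w, dw` with `w' = dw`, `dw' = q w` within `[a, b]` at every point of `[a, b]` (extend `q`
continuously by `q ∘ projIcc` and solve on the open half-line `(a - 1, ∞)` with
`exists_solution_Ioi`). [cite: Hartman2002, Ch. IV Lemma 1.1] -/
theorem exists_solution_Icc {q : ℝ → 𝕜} {a b t₀ : ℝ} (hq : ContinuousOn q (Icc a b))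
    (ht₀ : t₀ ∈ Icc a b) (c₀ c₁ : 𝕜) :
    ∃ w dw : ℝ → 𝕜, w t₀ = c₀ ∧ dw t₀ = c₁ ∧ ∀ t ∈ Icc a b,
      HasDerivWithinAt w (dw t) (Icc a b) t ∧ HasDerivWithinAt dw (q t * w t) (Icc a b) t := by
  have hab : a ≤ b := ht₀.1.trans ht₀.2
  set Q : ℝ → 𝕜 := fun t ↦ q (projIcc a b hab t) with hQ
  have hQc : Continuous Q :=
    hq.comp_continuous (continuous_subtype_val.comp continuous_projIcc) fun t ↦
      (projIcc a b hab t).2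
  have hQq : ∀ t ∈ Icc a b, Q t = q t := fun t ht ↦ by
    simp only [hQ, projIcc_of_mem hab ht]
  obtain ⟨w, dw, hw0, hw1, hsol⟩ := exists_solution_Ioi (p := fun _ ↦ (0 : 𝕜)) (q := Q)
    (r₀ := a - 1) continuousOn_const hQc.continuousOn t₀ c₀ c₁
  refine ⟨w, dw, hw0, hw1, fun t ht ↦ ?_⟩
  have ht' : t ∈ Ioi (a - 1) := by simp only [mem_Ioi]; linarith [ht.1]
  refine ⟨(hsol t ht').1.hasDerivWithinAt, ?_⟩
  have := (hsol t ht').2.hasDerivWithinAt (s := Icc a b)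
  simpa [hQq t ht] using this

end Literature.Analysis.ODE
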